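import Summits.CriticalPhenomena.CardyFormulaZ2.Theorems.CardyBondTriangularBondTriangularCardyKiteBStep
import HarnessLib

/-!
# Route CardyBondTriangular · crux `BondTriangularCardy` · line `birth`: the kite interface never crosses a yellow chord loop

Helper of the stub `stub_blueArm`. The winding labels of the colour-free toolkit
(`TriFaceLabel.lean`, `TriChordSides*.lean`: `faceLabel` of the faces of `𝕋` with respect to the
chord loop `chordLoop Q nv len` of a lattice path `Q` closed along the outer heads) along the walk
of the kite interface (`…KiteBDarts`, `…KiteBStep`), for the chord loop of a **yellow path of
hexagons** — consecutive hexagons yellow at a common corner, the two end hexagons yellow at a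
corner shared with the outer head (the Chayes–Lei form of an admissible open path): a bond one of
whose hexagons (in `G`) is blue at both ends of the common edge is not a bond of the loop
(`lbond_eq_zero_of_blue`); hence **the label of the corner of the left (blue) kite is constant
along the walk** (`faceLabel_leftCorner_succ`: a step moves that corner along an edge whose left
hexagon is blue at both ends, or through the blue half of a split hexagon of `G`); the face left
of the dart between consecutive distinct right cells is that corner (`leftFace_rightCell_succ`),
and the face left of the boundary dart towards an outer right cell has the same label unless that
dart is one of the two end darts of the path (`faceLabel_leftFace_outer`). These replace
`cyc_faceLabel_chordLoop_eq` / `cyc_succ_eq_leftFace` of the site proof (`TriClaim10Cycle.lean`).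

## References

* B. Bollobás, O. Riordan, *Percolation*, CUP (2006), Ch. 7, Claim 10 pp. 178–179.
-/

namespace Summit.CriticalPhenomena.CardyFormulaZ2.Theorems.BondTriangularCardyLine.KiteB

open Literature.Probability.Percolation Literature.Probability.LatticeModels
open RemovableAt (hexFaceVertices_leftFaceDir leftFaceDir_injective)
open TriMarkedDomain (fin3_add_one_add_one fin3_add_two_add_one fin3_add_two_add_two fin3_add_one_add_two)

section Label

variable {D : TriMarkedDomain 3} {σ : CLHexConfig} {Q : List (Site 2)} (hQ : Q ≠ []) (hQG : ∀ s ∈ Q, s ∈ D.verts)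
  (hQY : ∀ d ∈ pathDarts Q, ∃ G : HexVertex, d.1 ∈ hexFaceVertices G ∧ d.2 ∈ hexFaceVertices G ∧
    ccol D σ d.1 G = true ∧ ccol D σ d.2 G = true)
  {nv len : ℕ}
  (hlast : ∃ G : HexVertex, Q.getLast hQ ∈ hexFaceVertices G ∧ D.bdryHead nv ∈ hexFaceVertices G ∧
    ccol D σ (Q.getLast hQ) G = true)
  (hhead : ∃ G : HexVertex, Q.head hQ ∈ hexFaceVertices G ∧ D.bdryHead (nv + len) ∈ hexFaceVertices G ∧
    ccol D σ (Q.head hQ) G = true)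

/-- **A common corner of an adjacent pair is one of the two ends of their common edge**
(registered anchor of this file). -/
theorem eq_or_eq_of_common : ∀ {p q : Literature.Probability.LatticeModels.Site 2}, Literature.Probability.LatticeModels.triGraph.Adj p q → ∀ {G₁ G₂ G : Literature.Probability.LatticeModels.HexVertex}, G₁ ≠ G₂ → p ∈ Literature.Probability.LatticeModels.hexFaceVertices G₁ → q ∈ Literature.Probability.LatticeModels.hexFaceVertices G₁ → p ∈ Literature.Probability.LatticeModels.hexFaceVertices G₂ → q ∈ Literature.Probability.LatticeModels.hexFaceVertices G₂ → p ∈ Literature.Probability.LatticeModels.hexFaceVertices G → q ∈ Literature.Probability.LatticeModels.hexFaceVertices G → G = G₁ ∨ G = G₂ := by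
  intro p q hpq G₁ G₂ G hne hp1 hq1 hp2 hq2 hp hq
  obtain ⟨k, k', -, -, -, hF⟩ := common_corners hpq
  have h1 := (hF G₁).1 ⟨hp1, hq1⟩
  have h2 := (hF G₂).1 ⟨hp2, hq2⟩
  have h := (hF G).1 ⟨hp, hq⟩
  rcases h1 with rfl | rfl <;> rcases h2 with rfl | rfl
  · exact absurd rfl hne
  · exact h
  · exact h.symm
  · exact absurd rfl hne

include hQY hlast hhead in
/-- **A bond with a hexagon of `G` blue at both ends of the common edge is not a bond of the chord
loop of a yellow path**: not a bond of the path (consecutive hexagons are yellow at a common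
corner), not one of the two connecting bonds (the end hexagon is yellow at a corner shared with
the head), not a bond between outer heads. -/
theorem lbond_eq_zero_of_blue {p q : Site 2} (hpq : triGraph.Adj p q) (hp : p ∈ D.verts) {G₁ G₂ : HexVertex}
    (hne : G₁ ≠ G₂) (hp1 : p ∈ hexFaceVertices G₁) (hq1 : q ∈ hexFaceVertices G₁) (hp2 : p ∈ hexFaceVertices G₂)
    (hq2 : q ∈ hexFaceVertices G₂) (c1 : ccol D σ p G₁ = false) (c2 : ccol D σ p G₂ = false) :
    lbond (cycDarts (D.chordLoop Q nv len)) p q = 0 := by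
  -- no dart of the loop spans `{p, q}` with `p` yellow at a common corner
  have key : ∀ a b : Site 2, s(a, b) = s(p, q) → ∀ G : HexVertex, a ∈ hexFaceVertices G → b ∈ hexFaceVertices G →
      (a = p → ccol D σ a G = true → False) ∧ (b = p → ccol D σ b G = true → False) := by
    intro a b he G ha hb
    have hab : (a = p ∧ b = q) ∨ (a = q ∧ b = p) := Sym2.eq_iff.1 he
    have hG : G = G₁ ∨ G = G₂ := by
      rcases hab with ⟨rfl, rfl⟩ | ⟨rfl, rfl⟩
      · exact eq_or_eq_of_common hpq hne hp1 hq1 hp2 hq2 ha hb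
      · exact eq_or_eq_of_common hpq hne hp1 hq1 hp2 hq2 hb ha
    constructor
    · rintro rfl hc
      rcases hG with rfl | rfl
      · rw [c1] at hc; exact absurd hc (by decide)
      · rw [c2] at hc; exact absurd hc (by decide)
    · rintro rfl hc
      rcases hG with rfl | rfl
      · rw [c1] at hc; exact absurd hc (by decide)
      · rw [c2] at hc; exact absurd hc (by decide)
  refine lbond_eq_zero_of_forall_sym2_ne fun d hd he => ?_
  have hpd : d.1 = p ∨ d.2 = p := by
    have : p ∈ s(d.1, d.2) := by rw [he]; exact Sym2.mem_mk_left _ _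
    rcases Sym2.mem_iff.1 this with h | h
    · exact Or.inl h.symm
    · exact Or.inr h.symm
  rw [D.cycDarts_chordLoop hQ, List.mem_append, List.mem_cons, List.mem_append, List.mem_singleton] at hd
  rcases hd with hd | rfl | hd | rfl
  · obtain ⟨G, ha, hb, ca, cb⟩ := hQY d hd
    obtain ⟨k1, k2⟩ := key d.1 d.2 he G ha hb
    rcases hpd with h | h
    · exact k1 h ca
    · exact k2 h cb
  · obtain ⟨G, ha, hb, ca⟩ := hlast
    rcases hpd with h | h
    · exact (key _ _ he G ha hb).1 h ca
    · exact D.bdryHead_not_mem nv (by simp only at h; rw [h]; exact hp)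
  · obtain ⟨r, -, -, -, rfl⟩ := D.mem_pathDarts_headsList hd
    rcases hpd with h | h
    · exact D.bdryHead_not_mem r (by simp only at h; rw [h]; exact hp)
    · exact D.bdryHead_not_mem (r + 1) (by simp only at h; rw [h]; exact hp)
  · obtain ⟨G, ha, hb, ca⟩ := hhead
    rcases hpd with h | h
    · exact D.bdryHead_not_mem (nv + len) (by simp only at h; rw [h]; exact hp)
    · exact (key _ _ he G hb ha).2 h ca

include hQY hlast hhead in
/-- **Turning inside a hexagon of `G` through blue kites does not change the label**: the corners
in directions `k` and `k + 1` of a hexagon of `G` blue at both have equal labels (they are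
adjacent across the bond to the neighbour in direction `k + 1`, whose edge has exactly these two
ends). -/
theorem faceLabel_leftFaceDir_succ_of_blue (hC : ∀ d ∈ cycDarts (D.chordLoop Q nv len), triGraph.Adj d.1 d.2)
    {x : Site 2} (hx : x ∈ D.verts) (k : Fin 6)
    (c0 : ccol D σ x (leftFaceDir x k) = false) (c1 : ccol D σ x (leftFaceDir x (k + 1)) = false) :
    faceLabel (cycDarts (D.chordLoop Q nv len)) (leftFaceDir x k) =
      faceLabel (cycDarts (D.chordLoop Q nv len)) (leftFaceDir x (k + 1)) := by
  refine faceLabel_eq_of_adj hC (hexGraph_adj_leftFaceDir_succ x k) fun a b hab => ?_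
  rw [faceEdge_leftFaceDir_succ] at hab
  set n := x + triDir (k + 1) with hn
  have hadj : triGraph.Adj x n := triGraph_adj_add_triDir _ _
  have hne : leftFaceDir x k ≠ leftFaceDir x (k + 1) := fun e =>
    absurd (left_eq_add.1 (leftFaceDir_injective x e)) (by decide)
  have mx0 : x ∈ hexFaceVertices (leftFaceDir x k) := by rw [hexFaceVertices_leftFaceDir]; simp
  have mx1 : x ∈ hexFaceVertices (leftFaceDir x (k + 1)) := by rw [hexFaceVertices_leftFaceDir]; simp
  have mn0 : n ∈ hexFaceVertices (leftFaceDir x k) := by rw [hexFaceVertices_leftFaceDir]; simp [hn]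
  have mn1 : n ∈ hexFaceVertices (leftFaceDir x (k + 1)) := by rw [hexFaceVertices_leftFaceDir]; simp [hn]
  have h0 := lbond_eq_zero_of_blue hQ hQY hlast hhead hadj hx hne mx0 mn0 mx1 mn1 c0 c1
  -- `{a, b} = {x, n}`
  have ha : a ∈ ({x, n} : Finset (Site 2)) := by rw [hab]; simp
  have hb : b ∈ ({x, n} : Finset (Site 2)) := by rw [hab]; simp
  have hxab : x ∈ ({a, b} : Finset (Site 2)) := by rw [← hab]; simp
  have hnab : n ∈ ({a, b} : Finset (Site 2)) := by rw [← hab]; simp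
  simp only [Finset.mem_insert, Finset.mem_singleton] at ha hb hxab hnab
  have hxn : x ≠ n := hadj.ne
  rcases ha with rfl | rfl <;> rcases hb with rfl | rfl
  · rcases hnab with h | h <;> exact absurd h.symm hxn
  · exact h0
  · rw [lbond_comm]; exact h0
  · rcases hxab with h | h <;> exact absurd h hxn

include hQY hlast hhead in
/-- **The label of the corner of the left kite is constant along the walk** (for an admissible
interface dart with left cell in `G` whose successor has its left cell in `G` too): across an
edge the left hexagon is blue at both ends; through a hexagon of `G` the walk runs between its
blue and yellow halves, from a blue corner to a blue corner. -/
theorem faceLabel_leftCorner_succ (hC : ∀ d ∈ cycDarts (D.chordLoop Q nv len), triGraph.Adj d.1 d.2)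
    {d : KDart} (hd : iface (kcol D σ) d = true) (hadm : d.adm = true) (hG : d.leftCell ∈ D.verts)
    (hG' : (succ (kcol D σ) d).leftCell ∈ D.verts) :
    faceLabel (cycDarts (D.chordLoop Q nv len)) (succ (kcol D σ) d).leftCorner =
      faceLabel (cycDarts (D.chordLoop Q nv len)) d.leftCorner := by
  have hd' := hd
  rw [iface_iff'] at hd
  obtain ⟨hl, hr⟩ := hd
  cases d with
  | toMid F j =>
    simp only [KDart.leftCell, KDart.rightCell, KDart.leftCorner, KDart.rightCorner, ccol_faceVertex] at hl hr hG
    have e1 := faceVertex_oppFace_succ F j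
    have e2 := faceVertex_oppFace_succ_succ F j
    have hne : F ≠ oppFace F j := (hexGraph_adj_oppFace F j).ne
    have m1 : faceVertex F (j + 2) ∈ hexFaceVertices (oppFace F j) := e1 ▸ faceVertex_mem _ _
    have m2 : faceVertex F (j + 1) ∈ hexFaceVertices (oppFace F j) := e2 ▸ faceVertex_mem _ _
    -- across the edge: the left hexagon blue at both ends
    have hacross : kcol D σ (oppFace F j) (oppIdx F j + 1) = false →
        faceLabel (cycDarts (D.chordLoop Q nv len)) (oppFace F j) = faceLabel (cycDarts (D.chordLoop Q nv len)) F := by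
      intro h1
      rw [kcol_oppIdx_succ] at h1
      have h0 := lbond_eq_zero_of_blue hQ hQY hlast hhead (adj_exitDart F j) hG hne (faceVertex_mem _ _)
        (faceVertex_mem _ _) m1 m2 (by rw [ccol_faceVertex]; exact hl) h1
      have hrule := faceLabel_add_faceLabel_oppFace hC F j
      rw [lbond_comm] at h0
      rw [h0] at hrule
      have key : ∀ a b : ZMod 2, a + b = 0 → b = a := by decide
      exact key _ _ hrule
    simp only [succ]
    split_ifs with h1 h2
    · simp only [KDart.leftCorner, leftFace_succ_succ]
    · simp only [KDart.leftCorner]; exact hacross (by simpa using h1)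
    · simp only [KDart.leftCorner, leftFace_faceVertex_rev]; exact hacross (by simpa using h1)
  | fromMid F j => simp only [succ]; split_ifs <;> rfl
  | toCtr x y =>
    simp only [KDart.leftCell, KDart.rightCell, KDart.leftCorner, KDart.rightCorner] at hl hr hG
    obtain ⟨k, rfl⟩ := (triGraph_adj_iff_triDir x y).1 ((KDart.adm_toCtr x y).1 hadm)
    rw [leftFace_add_triDir_rev, ccol_leftFaceDir hG] at hl
    rw [leftFace_add_triDir, ccol_leftFaceDir hG] at hr
    obtain ⟨h3, h4, -, -⟩ := ytab_halves (σ x) k hl hr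
    simp only [succ, KDart.leftCorner, opp_eq, leftFace_add_triDir, leftFace_add_triDir_rev]
    have s1 := faceLabel_leftFaceDir_succ_of_blue hQ hQY hlast hhead hC hG (k + 3)
      (by rw [ccol_leftFaceDir hG]; exact h3) (by rw [ccol_leftFaceDir hG, show k + 3 + 1 = k + 4 by rw [add_assoc]; rfl]; exact h4)
    have s2 := faceLabel_leftFaceDir_succ_of_blue hQ hQY hlast hhead hC hG (k + 4)
      (by rw [ccol_leftFaceDir hG]; exact h4) (by rw [ccol_leftFaceDir hG, show k + 4 + 1 = k + 5 by rw [add_assoc]; rfl]; exact hl)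
    rw [show k + 3 + 1 = k + 4 by rw [add_assoc]; rfl] at s1
    rw [show k + 4 + 1 = k + 5 by rw [add_assoc]; rfl] at s2
    rw [s1, s2]
  | fromCtr x y =>
    simp only [KDart.leftCell, KDart.rightCell, KDart.leftCorner, KDart.rightCorner] at hl hr hG
    have h := (KDart.adm_fromCtr x y).1 hadm
    obtain ⟨m1, m2, m3, m4⟩ := mem_leftFace_four h
    simp only [succ, kc_kcol] at hG' ⊢
    split_ifs at hG' ⊢ with h1 h2
    · rfl
    · rfl
    · -- turned right: the new left hexagon `y ∈ G` is blue at both ends of the edge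
      simp only [KDart.leftCell, KDart.leftCorner] at hG' ⊢
      obtain ⟨hy', -⟩ := faceVertex_kidx_leftFace h.symm
      rw [fin3_add_two_add_one, hy'] at hG'
      have h0 := lbond_eq_zero_of_blue hQ hQY hlast hhead h.symm hG' (leftFace_ne_leftFace_rev h) m2 m1 m4 m3
        (by simpa using h1) (by simpa using h2)
      obtain ⟨k, rfl⟩ := (triGraph_adj_iff_triDir x y).1 h
      rw [leftFace_add_triDir, leftFace_add_triDir_rev]
      have hadj := hexGraph_adj_leftFaceDir_succ x (k + 5)
      have hedge := faceEdge_leftFaceDir_succ x (k + 5)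
      rw [show k + 5 + 1 = k by rw [add_assoc]; exact add_eq_left.2 (by decide)] at hadj hedge
      refine faceLabel_eq_of_adj hC hadj fun a b hab => ?_
      rw [hedge] at hab
      have ha : a ∈ ({x, x + triDir k} : Finset (Site 2)) := by rw [hab]; simp
      have hb : b ∈ ({x, x + triDir k} : Finset (Site 2)) := by rw [hab]; simp
      have hxab : x ∈ ({a, b} : Finset (Site 2)) := by rw [← hab]; simp
      have hnab : x + triDir k ∈ ({a, b} : Finset (Site 2)) := by rw [← hab]; simp
      simp only [Finset.mem_insert, Finset.mem_singleton] at ha hb hxab hnab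
      have hxn : x ≠ x + triDir k := (triGraph_adj_add_triDir x k).ne
      rcases ha with rfl | rfl <;> rcases hb with rfl | rfl
      · rcases hnab with h' | h' <;> exact absurd h'.symm hxn
      · rw [lbond_comm]; exact h0
      · exact h0
      · rcases hxab with h' | h' <;> exact absurd h' hxn

/-- **When the right cell changes, the old corner of the left kite is the face left of the dart
from the old right cell to the new one** (the face of the walk at that turn). -/
theorem leftFace_rightCell_succ {d : KDart} (hadm : d.adm = true)
    (hne : (succ (kcol D σ) d).rightCell ≠ d.rightCell) :
    leftFace d.rightCell (succ (kcol D σ) d).rightCell = d.leftCorner := by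
  cases d with
  | toMid F j =>
    simp only [succ] at hne ⊢
    split_ifs at hne ⊢ with h1 h2
    · exact leftFace_succ_succ F j
    · exact absurd (faceVertex_oppFace_succ_succ F j) hne
    · exact absurd rfl hne
  | fromMid F j =>
    simp only [succ] at hne ⊢
    split_ifs at hne ⊢ with h1
    · simp only [KDart.rightCell, KDart.leftCorner, fin3_add_two_add_one]
      have := leftFace_faceVertex F (j + 2)
      rwa [fin3_add_two_add_one] at this
    · simp only [KDart.rightCell, fin3_add_one_add_one] at hne; exact absurd rfl hne
  | toCtr x y => exact absurd rfl hne
  | fromCtr x y =>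
    have h := (KDart.adm_fromCtr x y).1 hadm
    simp only [succ] at hne ⊢
    split_ifs at hne ⊢ with h1 h2
    · simp only [KDart.rightCell, KDart.leftCorner, fin3_add_two_add_two, (faceVertex_kidx_leftFace h).2]
    · rfl
    · simp only [KDart.rightCell, fin3_add_two_add_two, (faceVertex_kidx_leftFace h.symm).2] at hne
      exact absurd rfl hne

include hQG in
/-- **An outer right cell is seen from the left cell across a boundary dart whose left face has
the label of the walk**, unless that dart is one of the two end darts of the path (the label of
the face left of `ℓ → o` is that of the corner of the left kite plus the multiplicity of the bond
`{ℓ, o}`, a bond of the loop only as an end dart). -/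
theorem faceLabel_leftFace_outer (hC : ∀ d ∈ cycDarts (D.chordLoop Q nv len), triGraph.Adj d.1 d.2)
    {d : KDart} (hd : iface (kcol D σ) d = true) (hadm : d.adm = true) (hG : d.leftCell ∈ D.verts)
    (hout : d.rightCell ∉ D.verts) :
    faceLabel (cycDarts (D.chordLoop Q nv len)) (leftFace d.leftCell d.rightCell) =
        faceLabel (cycDarts (D.chordLoop Q nv len)) d.leftCorner ∨
      (d.leftCell = Q.getLast hQ ∧ d.rightCell = D.bdryHead nv) ∨
      (d.leftCell = Q.head hQ ∧ d.rightCell = D.bdryHead (nv + len)) := by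
  cases d with
  | toMid F j =>
    simp only [KDart.leftCell, KDart.rightCell, KDart.leftCorner] at hG hout ⊢
    rw [leftFace_faceVertex_rev]
    by_cases h0 : lbond (cycDarts (D.chordLoop Q nv len)) (faceVertex F (j + 1)) (faceVertex F (j + 2)) = 0
    · left
      have hrule := faceLabel_add_faceLabel_oppFace hC F j
      rw [h0] at hrule
      have key : ∀ a b : ZMod 2, a + b = 0 → b = a := by decide
      exact key _ _ hrule
    · right
      -- some dart of the loop spans the bond: an end dart
      have hex : ∃ d ∈ cycDarts (D.chordLoop Q nv len), s(d.1, d.2) = s(faceVertex F (j + 1), faceVertex F (j + 2)) := by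
        by_contra hne
        push Not at hne
        exact h0 (lbond_eq_zero_of_forall_sym2_ne hne)
      obtain ⟨d, hd, he⟩ := hex
      rw [D.cycDarts_chordLoop hQ, List.mem_append, List.mem_cons, List.mem_append, List.mem_singleton] at hd
      have hcase : ∀ a b : Site 2, s(a, b) = s(faceVertex F (j + 1), faceVertex F (j + 2)) → a ∈ D.verts → b ∈ D.verts → False := by
        intro a b he' ha hb
        rcases Sym2.eq_iff.1 he' with ⟨rfl, -⟩ | ⟨-, rfl⟩
        · exact hout ha
        · exact hout hb
      rcases hd with hd | rfl | hd | rfl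
      · exact (hcase _ _ he (hQG _ (mem_of_mem_pathDarts hd).1) (hQG _ (mem_of_mem_pathDarts hd).2)).elim
      · left
        rcases Sym2.eq_iff.1 he with ⟨h1, h2⟩ | ⟨h1, h2⟩ <;> simp only at h1 h2
        · exact absurd (h1 ▸ hQG _ (List.getLast_mem hQ)) hout
        · exact ⟨h1.symm, h2.symm⟩
      · obtain ⟨r, -, -, -, rfl⟩ := D.mem_pathDarts_headsList hd
        rcases Sym2.eq_iff.1 he with ⟨-, h2⟩ | ⟨h1, -⟩
        · simp only at h2; exact absurd (h2 ▸ hG) (D.bdryHead_not_mem (r + 1))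
        · simp only at h1; exact absurd (h1 ▸ hG) (D.bdryHead_not_mem r)
      · right
        rcases Sym2.eq_iff.1 he with ⟨h1, h2⟩ | ⟨h1, h2⟩ <;> simp only at h1 h2
        · exact ⟨h2.symm, h1.symm⟩
        · exact absurd (h2 ▸ hQG _ (List.head_mem hQ)) hout
  | fromMid F j => left; simp only [KDart.leftCell, KDart.rightCell, KDart.leftCorner]; rw [leftFace_succ_succ]
  | toCtr x y => exact absurd hG hout
  | fromCtr x y => exact absurd hG hout

end Label

end Summit.CriticalPhenomena.CardyFormulaZ2.Theorems.BondTriangularCardyLine.KiteB
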